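import Summits.QuantumFields.YangMills.Theorems.BalabanUVNodesN15BackgroundSiteOfLetters
import HarnessLib

/-!
# Route «BalabanUVNodes» (K4 «SpineRates»), node N15 = NE2 — THE UNIT-LATTICE LAYER WITH THE BACKGROUND LIVE, I: THE DRESSED UNIT FORM
# `K = a − a²(Q + F₂)X(Q* + F₂*)` (King's `C^{(k)} = (a − a²QG_kQ*)⁻¹` shape with `Q(U′U) = Q + F₂`, `G(U′U) = X`), its perturbation `K − K₀` (small) and its η-defect
# `𝔇(K′, K)` by Leibniz — NO rate loss (one dressed factor); fed to S1's exact inverse rule and S4's three letters of the dressed propagator: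
# ★ `hasMaj_idef_dressedUnit` — the η-defect of the dressed unit-lattice covariances from the letters

Cell `pub-ymgap`, seat `pub-ymgap-dag-n15-c` (generation g5; R134 ACCELERATION SEAT, strategy s1; HUMAN RULING D-0062; chair R424 venue; `bears_on: R4∕N15`).  Filed
`--supports stmt-QuantumFields-20292 --as helper` (K3⁗; count-neutral).  Imports this seat's S4 `…N15BackgroundSiteOfLetters` (`dressedOp` and its three letters, `xAmp`;
through it S1 `siteInv`∕`hasMaj_idef_siteInv`, S2's helpers, g4 F1 `fibAvg`∕`fibAvg_comp_pull`, `T4EtaRateCoeffDefect.hasMaj_mulOp`, `B6Prop26Gluing.mulOp`) BY NAME; nothing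
in the tree is modified.

THE PRINT (SHAPE and MECHANISM only).  The unit-lattice covariance of a block-spin tower is built on the EFFECTIVE operator `a − a²QG_kQ*` ([King1986] (2.14) p. 653: the effective
Laplacian «Δ^{(k)} = a_k(L^kε)^{−2}I − a_k²(L^kε)^{−4}Q_k(A)G_k(A)Q_k(A)*», and (2.16) p. 653: the next covariance «C^{(k)} = (Δ^{(k)} + a(L^kε)^{−2}Q*Q)^{−1}»; the -d∕-e King-model
rung's `effLaplacian`; ERRATUM 2026-08-27: earlier copies of this locator in the g5 U∕R-series read «(4.33) p.673» — (4.33) p. 674 is the positivity condition «C_Ω^{(k)}(s) ≥ γ₀I»,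
(4.34) p. 674 the decay; the SHAPE is (2.14)); [Balaban1985BackgroundPropagators] Thm 3.15 (3.187)
p. 432 types the background-dependent `C^{(k)}(Λ; U)` with the same majorant shape.  With the background live around `U ≡ 1` (`Q(U′U) = Q + F₂`, `Q*(U′U) = Q* + F₂*`,
`G(U′U) = X` = the lineage's dressed propagator) the dressed unit form is `K = a·1 − a²·(Q + F₂)∘X∘(Q* + F₂*)` and `K₀ = a·1 − a²·Q∘G∘Q*`; the dressed unit covariance is
S1's `siteInv W K₀ K` for the `U ≡ 1` unit covariance `W = K₀⁻¹` (a BINDER — King's `C^{(k)}`-type object at `U ≡ 1` with its uniform majorant (4.34)∕(3.187)), and its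
η-defect is `−W′·𝔇(K′, K)·W`-shaped by the exact inverse rule.  HERE: the words of `K` — ONE dressed factor, so NO (2.61) row sum and NO rate loss in the words.

CONTENTS ([folklore]: finite-dimensional linear algebra + the lineage's lemmas BY NAME; 2 defs).
* §1 `unitForm a q F Fs X`, `unitForm₀ a q G`, `unitForm_sub_unitForm₀` (`K − K₀ = −a²·[F₂X(Q* + F₂*) + QXF₂* + Q(X − G)Q*]`).
* §2 ★ `hasMaj_unitC` (`K − K₀ ≤ a²(rB(1+r) + Br + ε)·e^{−δd}` at the letters' own rate), ★ `hasMaj_idef_unitForm` (`𝔇(K′, K) ≤ a²(1+r)(2Bo + m(1+r))·e^{−δd}`; the identity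
  parts and the `Q`-defects vanish).
* §3 `cAmpU`, `uAmp`, ★★ **`hasMaj_idef_dressedUnit`** — from the `U ≡ 1` layer `G, D_μ`, ANY perturbation with the three letters, ANY averaging species with block-local
  letters, and the `U ≡ 1` unit covariances `W, W′ ≤ β_W·e^{−δd}` with `K₀W = 1 = K₀′W′`, site guard `β_W·cAmpU·c_r² ≤ ½`, `4σ ≤ δ`:
  `𝔇([K′]⁻¹, [K]⁻¹) ≤ uAmp·θ·e^{−(δ−4σ)d}`.

HONEST FRAMING ∕ LIMITS.  MECHANISM over binders: the `U ≡ 1` layer, the perturbation and species letters and the `U ≡ 1` unit covariances are hypotheses (the sequel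
discharges the letters from (3.35) on the gauge carrier; `W` stays displayed); in the lineage's vector-PIECE instantiation `K₀ = a − a²Q(G⊗1)Q*` is the FORMAL unit-layer
analogue built from the single-scale piece — King's identity `C^{(k)} = (a − a²QG_kQ*)⁻¹` holds for the FULL fine propagator `G_k`, not for one piece.  Nothing about
Bałaban's `C^{(k)}(Λ;U)` is asserted; NE2⁺ NOT PRINTED, NOT proved; count-neutral (typed 28∕28; discharged count unchanged); N15 NOT discharged; one finite T⁴ at fixed ε —
NOT infinite volume, NOT OS on ℝ⁴, NOT a mass gap, NOT Clay.
-/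

noncomputable section

namespace Summit.QuantumFields.YangMills.BalabanUVNodes.N15.SiteLayer

open Literature.MathematicalPhysics.QuantumFieldTheory.Balaban1983to89
open Literature.MathematicalPhysics.QuantumFieldTheory.Balaban1983to89.B11SectG (BlockNorm HasMaj hasMaj_comp hasMaj_comp_exp RowSum)
open Literature.MathematicalPhysics.QuantumFieldTheory.Balaban1983to89.T4EtaRateDefect (idef idef_comp idef_add idef_sub)
open Literature.MathematicalPhysics.QuantumFieldTheory.Balaban1983to89.T4EtaRateCoeffDefect (pull pull_apply diagK diagK_nonneg diagK_mono fibre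
  hasMaj_pull hasMaj_mulOp)
open Literature.MathematicalPhysics.QuantumFieldTheory.Balaban1983to89.B6RandomWalk (Triangle254)
open Literature.MathematicalPhysics.QuantumFieldTheory.Balaban1983to89.B6Prop26Gluing (mulOp mulOp_apply)
open Literature.MathematicalPhysics.QuantumFieldTheory.Balaban1983to89.B9SectDSup (inv_one_sub_le_two)
open Summit.QuantumFields.YangMills.BalabanUVNodes.N15.DerivDefect (sum_mul_diagK sum_diagK_mul)
open Summit.QuantumFields.YangMills.BalabanUVNodes.N15.BackgroundModel (kappa_ofBlocks)
open Summit.QuantumFields.YangMills.BalabanUVNodes.N15.BackgroundLayer (fibAvg fibAvg_comp_pull idef_fibAvg_eq_zero idef_pull_eq_zero hasMaj_fibAvg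
  hasMaj_add_diagK hasMaj_comp_diagK blkPair liftPair bgConst bgConst_nonneg)

/-! ## §1 The dressed unit form and its `U ≡ 1` member -/

section Forms

variable {X Y : Type} [Fintype X] [DecidableEq Y]

/-- THE DRESSED UNIT FORM `K = a·1 − a²·(Q + F₂)∘X∘(Q* + F₂*)` (King's effective operator with `Q(U′U) = Q + F₂`, `G(U′U) = X`). [cite: King1986, (2.14) p.653 («Δ^{(k)} = a_k − a_k²Q_kG_kQ_k*»: shape); Balaban1985BackgroundPropagators, Thm 3.15 (3.187) p.432 (shape)] -/
def unitForm (a : ℝ) (q : X → Y) (F : (X → ℝ) →ₗ[ℝ] (Y → ℝ)) (Fs : (Y → ℝ) →ₗ[ℝ] (X → ℝ)) (Xo : (X → ℝ) →ₗ[ℝ] (X → ℝ)) :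
    (Y → ℝ) →ₗ[ℝ] (Y → ℝ) :=
  mulOp (fun _ => a) - mulOp (fun _ => a * a) ∘ₗ ((fibAvg q + F) ∘ₗ (Xo ∘ₗ (pull q + Fs)))

/-- THE `U ≡ 1` UNIT FORM `K₀ = a·1 − a²·Q∘G∘Q*`. [cite: King1986, (2.14) p.653 (shape)] -/
def unitForm₀ (a : ℝ) (q : X → Y) (G : (X → ℝ) →ₗ[ℝ] (X → ℝ)) : (Y → ℝ) →ₗ[ℝ] (Y → ℝ) :=
  mulOp (fun _ => a) - mulOp (fun _ => a * a) ∘ₗ (fibAvg q ∘ₗ (G ∘ₗ pull q))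

/-- `K − K₀ = −a²·[F₂X(Q* + F₂*) + QXF₂* + Q(X − G)Q*]`. [folklore] -/
theorem unitForm_sub_unitForm₀ (a : ℝ) (q : X → Y) (F : (X → ℝ) →ₗ[ℝ] (Y → ℝ)) (Fs : (Y → ℝ) →ₗ[ℝ] (X → ℝ)) (Xo G : (X → ℝ) →ₗ[ℝ] (X → ℝ)) :
    unitForm a q F Fs Xo - unitForm₀ a q G =
      -(mulOp (fun _ => a * a) ∘ₗ (F ∘ₗ (Xo ∘ₗ (pull q + Fs)) + fibAvg q ∘ₗ (Xo ∘ₗ Fs) + fibAvg q ∘ₗ ((Xo - G) ∘ₗ pull q))) := by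
  refine LinearMap.ext fun v => funext fun y => ?_
  simp only [unitForm, unitForm₀, LinearMap.sub_apply, LinearMap.add_apply, LinearMap.comp_apply, LinearMap.neg_apply, map_add, map_sub, mulOp_apply,
    Pi.sub_apply, Pi.add_apply, Pi.neg_apply]
  ring

end Forms

/-! ## §2 The perturbation and the η-defect of the dressed unit form (no rate loss) -/

section Letters

variable {X X' Y : Type} [Fintype X] [Fintype X'] [Fintype Y] [DecidableEq X] [DecidableEq Y] {g : B6.Geometry}

omit [DecidableEq X] in
/-- **`K − K₀ ≤ a²(rB(1 + r) + Br + ε)·e^{−δd}`** from `X ≤ B·e^{−δd}`, `X − G ≤ ε·e^{−δd}`, `F₂, F₂* ≤ diagK r`, `Q, Q* ≤ diagK 1` — at the letters' own rate (one dressed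
factor: no row sum). [cite: King1986, (2.14) p.653 (shape); Balaban1985BackgroundPropagators, (3.66) p.403 (shape: «O(1)α₁» small)] -/
theorem hasMaj_unitC (blk : X → g.Site) (blkY : Y → g.Site) (q : X → Y) (hq : ∀ x, blk x = blkY (q x)) (a : ℝ)
    {Xo G : (X → ℝ) →ₗ[ℝ] (X → ℝ)} {F : (X → ℝ) →ₗ[ℝ] (Y → ℝ)} {Fs : (Y → ℝ) →ₗ[ℝ] (X → ℝ)} {B ε r δ : ℝ} (hB : 0 ≤ B) (hε : 0 ≤ ε) (hr : 0 ≤ r)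
    (hX : HasMaj (BlockNorm.ofBlocks g blk) (BlockNorm.ofBlocks g blk) Xo (fun y y' => B * Real.exp (-(δ * g.dist y y'))))
    (hE : HasMaj (BlockNorm.ofBlocks g blk) (BlockNorm.ofBlocks g blk) (Xo - G) (fun y y' => ε * Real.exp (-(δ * g.dist y y'))))
    (hF : HasMaj (BlockNorm.ofBlocks g blk) (BlockNorm.ofBlocks g blkY) F (diagK fun _ => r))
    (hFs : HasMaj (BlockNorm.ofBlocks g blkY) (BlockNorm.ofBlocks g blk) Fs (diagK fun _ => r)) :
    HasMaj (BlockNorm.ofBlocks g blkY) (BlockNorm.ofBlocks g blkY) (unitForm a q F Fs Xo - unitForm₀ a q G)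
      (fun y y' => a * a * (r * (B * (1 + r)) + B * r + ε) * Real.exp (-(δ * g.dist y y'))) := by
  have hblk : blk = blkY ∘ q := funext hq
  subst hblk
  have hQ := hasMaj_fibAvg (g := g) (blkY ∘ q) blkY q fun _ => rfl
  have hQs : HasMaj (BlockNorm.ofBlocks g blkY) (BlockNorm.ofBlocks g (blkY ∘ q)) (pull q) (diagK fun _ => 1) := hasMaj_pull blkY q
  have hP : HasMaj (BlockNorm.ofBlocks g blkY) (BlockNorm.ofBlocks g (blkY ∘ q)) (pull q + Fs) (diagK fun _ => 1 + r) := hasMaj_add_diagK hQs hFs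
  have t1 : HasMaj (BlockNorm.ofBlocks g blkY) (BlockNorm.ofBlocks g blkY) (F ∘ₗ (Xo ∘ₗ (pull q + Fs)))
      (fun y y' => r * (B * (1 + r)) * Real.exp (-(δ * g.dist y y'))) :=
    hasMaj_diagK_comp_exp (blkY ∘ q) hr hF (hasMaj_exp_comp_diagK (blkY ∘ q) hB hX hP)
  have t2 : HasMaj (BlockNorm.ofBlocks g blkY) (BlockNorm.ofBlocks g blkY) (fibAvg q ∘ₗ (Xo ∘ₗ Fs))
      (fun y y' => 1 * (B * r) * Real.exp (-(δ * g.dist y y'))) :=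
    hasMaj_diagK_comp_exp (blkY ∘ q) zero_le_one hQ (hasMaj_exp_comp_diagK (blkY ∘ q) hB hX hFs)
  have t3 : HasMaj (BlockNorm.ofBlocks g blkY) (BlockNorm.ofBlocks g blkY) (fibAvg q ∘ₗ ((Xo - G) ∘ₗ pull q))
      (fun y y' => 1 * (ε * 1) * Real.exp (-(δ * g.dist y y'))) :=
    hasMaj_diagK_comp_exp (blkY ∘ q) zero_le_one hQ (hasMaj_exp_comp_diagK (blkY ∘ q) hε hE hQs)
  have hsum := (t1.add t2).add t3
  have hA : HasMaj (BlockNorm.ofBlocks g blkY) (BlockNorm.ofBlocks g blkY) (mulOp fun _ : Y => a * a) (diagK fun _ => a * a) :=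
    hasMaj_mulOp blkY (fun _ => mul_self_nonneg a) fun _ => (abs_mul_self a).le
  have key := hasMaj_diagK_comp_exp blkY (mul_self_nonneg a) hA
    (hsum.mono fun y y' => le_of_eq (by ring : _ = (r * (B * (1 + r)) + B * r + ε) * Real.exp (-(δ * g.dist y y'))))
  rw [unitForm_sub_unitForm₀]
  exact key.neg.mono fun y y' => le_of_eq (by ring)

/-- **THE η-DEFECT OF THE DRESSED UNIT FORM** through the identity transport of the common site lattice, lattice functions transported by `pull π` with uniform fibres:
`𝔇(K′, K) ≤ a²(1 + r)(2Bo + m(1 + r))·e^{−δd}` from `X′ ≤ B·e^{−δd}`, `𝔇(X′, X) ≤ m·e^{−δd}`, species letters `r`, fits `o` — the identity parts and the `Q`-defects VANISH,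
no row sum, no rate loss. [cite: King1986, (2.14) p.653 (shape); Balaban1985BackgroundPropagators, (3.65) p.403 (mechanism); King1986, p.664 (pairing)] -/
theorem hasMaj_idef_unitForm (blk : X → g.Site) (blkY : Y → g.Site) (q : X → Y) (π : X' → X) (hq : ∀ x, blk x = blkY (q x)) {N : ℕ} (hN : N ≠ 0)
    (hfib : ∀ x, (fibre π x).card = N) (a : ℝ)
    {Xo : (X → ℝ) →ₗ[ℝ] (X → ℝ)} {Xo' : (X' → ℝ) →ₗ[ℝ] (X' → ℝ)} {F : (X → ℝ) →ₗ[ℝ] (Y → ℝ)} {F' : (X' → ℝ) →ₗ[ℝ] (Y → ℝ)}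
    {Fs : (Y → ℝ) →ₗ[ℝ] (X → ℝ)} {Fs' : (Y → ℝ) →ₗ[ℝ] (X' → ℝ)} {B m r o δ : ℝ} (hB : 0 ≤ B) (hm : 0 ≤ m) (hr : 0 ≤ r) (ho : 0 ≤ o)
    (hX' : HasMaj (BlockNorm.ofBlocks g (blk ∘ π)) (BlockNorm.ofBlocks g (blk ∘ π)) Xo' (fun y y' => B * Real.exp (-(δ * g.dist y y'))))
    (hDX : HasMaj (BlockNorm.ofBlocks g blk) (BlockNorm.ofBlocks g (blk ∘ π)) (idef (pull π) (pull π) Xo' Xo)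
      (fun y y' => m * Real.exp (-(δ * g.dist y y'))))
    (hX : HasMaj (BlockNorm.ofBlocks g blk) (BlockNorm.ofBlocks g blk) Xo (fun y y' => B * Real.exp (-(δ * g.dist y y'))))
    (hFs : HasMaj (BlockNorm.ofBlocks g blkY) (BlockNorm.ofBlocks g blk) Fs (diagK fun _ => r))
    (hF' : HasMaj (BlockNorm.ofBlocks g (blk ∘ π)) (BlockNorm.ofBlocks g blkY) F' (diagK fun _ => r))
    (hFs' : HasMaj (BlockNorm.ofBlocks g blkY) (BlockNorm.ofBlocks g (blk ∘ π)) Fs' (diagK fun _ => r))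
    (hDF : HasMaj (BlockNorm.ofBlocks g blk) (BlockNorm.ofBlocks g blkY) (idef (pull π) LinearMap.id F' F) (diagK fun _ => o))
    (hDFs : HasMaj (BlockNorm.ofBlocks g blkY) (BlockNorm.ofBlocks g (blk ∘ π)) (idef LinearMap.id (pull π) Fs' Fs) (diagK fun _ => o)) :
    HasMaj (BlockNorm.ofBlocks g blkY) (BlockNorm.ofBlocks g blkY)
      (idef LinearMap.id LinearMap.id (unitForm a (q ∘ π) F' Fs' Xo') (unitForm a q F Fs Xo))
      (fun y y' => a * a * ((1 + r) * (B * o + m * (1 + r)) + o * (B * (1 + r))) * Real.exp (-(δ * g.dist y y'))) := by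
  have hblk : blk = blkY ∘ q := funext hq
  subst hblk
  have hQ' := hasMaj_fibAvg (g := g) ((blkY ∘ q) ∘ π) blkY (q ∘ π) fun _ => rfl
  have hQs : HasMaj (BlockNorm.ofBlocks g blkY) (BlockNorm.ofBlocks g (blkY ∘ q)) (pull q) (diagK fun _ => 1) := hasMaj_pull blkY q
  have hP' : HasMaj (BlockNorm.ofBlocks g ((blkY ∘ q) ∘ π)) (BlockNorm.ofBlocks g blkY) (fibAvg (q ∘ π) + F') (diagK fun _ => 1 + r) :=
    hasMaj_add_diagK hQ' hF'
  have hPs : HasMaj (BlockNorm.ofBlocks g blkY) (BlockNorm.ofBlocks g (blkY ∘ q)) (pull q + Fs) (diagK fun _ => 1 + r) := hasMaj_add_diagK hQs hFs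
  have e1 : idef LinearMap.id (pull π) (pull (q ∘ π) + Fs') (pull q + Fs) = idef LinearMap.id (pull π) Fs' Fs := by
    rw [idef_add, idef_pull_eq_zero q π, zero_add]
  have e2 : idef (pull π) LinearMap.id (fibAvg (q ∘ π) + F') (fibAvg q + F) = idef (pull π) LinearMap.id F' F := by
    rw [idef_add, idef_fibAvg_eq_zero q π hN hfib, zero_add]
  -- 𝔇(X′Ps′, XPs) = X′𝔇(Ps′,Ps) + 𝔇(X′,X)Ps ≤ (Bo + m(1+r))
  have hA1 : HasMaj (BlockNorm.ofBlocks g blkY) (BlockNorm.ofBlocks g ((blkY ∘ q) ∘ π))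
      (idef LinearMap.id (pull π) (pull (q ∘ π) + Fs') (pull q + Fs)) (diagK fun _ => o) := by rw [e1]; exact hDFs
  have hA2 : HasMaj (BlockNorm.ofBlocks g blkY) (BlockNorm.ofBlocks g ((blkY ∘ q) ∘ π))
      (idef LinearMap.id (pull π) (Xo' ∘ₗ (pull (q ∘ π) + Fs')) (Xo ∘ₗ (pull q + Fs))) (fun y y' => (B * o + m * (1 + r)) * Real.exp (-(δ * g.dist y y'))) := by
    rw [idef_comp LinearMap.id (pull π) (pull π)]
    exact hasMaj_add_exp (hasMaj_exp_comp_diagK ((blkY ∘ q) ∘ π) hB hX' hA1) (hasMaj_exp_comp_diagK (blkY ∘ q) hm hDX hPs)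
  -- P′ ∘ that
  have hA3 := hasMaj_diagK_comp_exp ((blkY ∘ q) ∘ π) (by linarith : (0 : ℝ) ≤ 1 + r) hP' hA2
  -- 𝔇(P′, P) ∘ (X ∘ Ps)
  have hDP : HasMaj (BlockNorm.ofBlocks g (blkY ∘ q)) (BlockNorm.ofBlocks g blkY) (idef (pull π) LinearMap.id (fibAvg (q ∘ π) + F') (fibAvg q + F))
      (diagK fun _ => o) := by rw [e2]; exact hDF
  have hA4 := hasMaj_diagK_comp_exp (blkY ∘ q) ho hDP (hasMaj_exp_comp_diagK (blkY ∘ q) hB hX hPs)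
  -- the words' defect
  have hW : HasMaj (BlockNorm.ofBlocks g blkY) (BlockNorm.ofBlocks g blkY)
      (idef LinearMap.id LinearMap.id ((fibAvg (q ∘ π) + F') ∘ₗ (Xo' ∘ₗ (pull (q ∘ π) + Fs'))) ((fibAvg q + F) ∘ₗ (Xo ∘ₗ (pull q + Fs))))
      (fun y y' => ((1 + r) * (B * o + m * (1 + r)) + o * (B * (1 + r))) * Real.exp (-(δ * g.dist y y'))) := by
    rw [idef_comp LinearMap.id (pull π) LinearMap.id]
    exact hasMaj_add_exp hA3 hA4
  -- the constant parts have zero defect; the factor a²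
  have hA : HasMaj (BlockNorm.ofBlocks g blkY) (BlockNorm.ofBlocks g blkY) (mulOp fun _ : Y => a * a) (diagK fun _ => a * a) :=
    hasMaj_mulOp blkY (fun _ => mul_self_nonneg a) fun _ => (abs_mul_self a).le
  have e3 : idef LinearMap.id LinearMap.id (unitForm a (q ∘ π) F' Fs' Xo') (unitForm a q F Fs Xo) =
      -(mulOp (fun _ : Y => a * a) ∘ₗ idef LinearMap.id LinearMap.id ((fibAvg (q ∘ π) + F') ∘ₗ (Xo' ∘ₗ (pull (q ∘ π) + Fs')))
        ((fibAvg q + F) ∘ₗ (Xo ∘ₗ (pull q + Fs)))) := by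
    refine LinearMap.ext fun v => funext fun y => ?_
    simp only [unitForm, idef, LinearMap.sub_apply, LinearMap.comp_apply, LinearMap.neg_apply, LinearMap.id_apply, map_sub, mulOp_apply, Pi.sub_apply,
      Pi.neg_apply]
    ring
  rw [e3]
  have hnn : 0 ≤ (1 + r) * (B * o + m * (1 + r)) + o * (B * (1 + r)) := by positivity
  exact (hasMaj_diagK_comp_exp blkY (mul_self_nonneg a) hA hW).neg.mono fun y y' => le_of_eq (by ring)

end Letters

/-! ## §3 The η-defect of the dressed unit covariances from the letters -/

section Dressed

/-- THE AMPLITUDE OF `K − K₀` per unit `a²`: `cAmpU = r·B(1+r) + Br + ε` at `B = xAmp`, `ε = β(R·B)c_r`. [folklore] -/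
def cAmpU (β R cr r : ℝ) : ℝ := r * (xAmp β R cr * (1 + r)) + xAmp β R cr * r + β * (R * xAmp β R cr) * cr

/-- `cAmpU ≥ 0`. [folklore] -/
theorem cAmpU_nonneg {β R cr r : ℝ} (hβ : 0 ≤ β) (hR : 0 ≤ R) (hcr : 0 ≤ cr) (hr : 0 ≤ r) (hq : β * R * cr < 1) : 0 ≤ cAmpU β R cr r := by
  have hx := xAmp_nonneg hβ hq
  unfold cAmpU; positivity

/-- THE AMPLITUDE OF THE UNIT-COVARIANCE η-DEFECT per unit rate `θ` (S1 `hasMaj_idef_siteInv` at `A = β_W(1 − β_W·a²cAmpU·c_r²)⁻¹`,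
`M = a²[(1+r)(2B o₀ + bgConst(1+r)) … ]·θ`). [folklore] -/
def uAmp (β R cr r m₀ K a₀ o₀ βW a : ℝ) : ℝ :=
  βW * (1 - βW * (a * a * cAmpU β R cr r) * cr * cr)⁻¹ *
    (a * a * ((1 + r) * (xAmp β R cr * o₀ + bgConst β cr m₀ K a₀ * (1 + r)) + o₀ * (xAmp β R cr * (1 + r)))) *
    (βW * (1 - βW * (a * a * cAmpU β R cr r) * cr * cr)⁻¹) * cr * cr

/-- `uAmp ≥ 0` below the two thresholds. [folklore] -/
theorem uAmp_nonneg {β R cr r m₀ K a₀ o₀ βW a : ℝ} (hβ : 0 ≤ β) (hcr : 0 ≤ cr) (hr : 0 ≤ r) (hm₀ : 0 ≤ m₀) (hK : 0 ≤ K) (ha₀ : 0 ≤ a₀) (ho₀ : 0 ≤ o₀)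
    (hβW : 0 ≤ βW) (hq1 : β * R * cr < 1) (hq2 : βW * (a * a * cAmpU β R cr r) * cr * cr < 1) : 0 ≤ uAmp β R cr r m₀ K a₀ o₀ βW a := by
  have hx := xAmp_nonneg hβ hq1
  have hb := bgConst_nonneg hβ hcr hm₀ hK ha₀
  have hA : 0 ≤ βW * (1 - βW * (a * a * cAmpU β R cr r) * cr * cr)⁻¹ := mul_nonneg hβW (inv_nonneg.2 (by linarith))
  have ha2 : 0 ≤ a * a := mul_self_nonneg a
  unfold uAmp; positivity

variable {X X' Y J : Type} [Fintype X] [Fintype X'] [Fintype Y] [Fintype J] [DecidableEq X] [DecidableEq X'] [DecidableEq Y] [DecidableEq J] {g : B6.Geometry}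
  {σ cr : ℝ}
variable {G : (X → ℝ) →ₗ[ℝ] (X → ℝ)} {D : J → (X → ℝ) →ₗ[ℝ] (X → ℝ)} {G' : (X' → ℝ) →ₗ[ℝ] (X' → ℝ)} {D' : J → (X' → ℝ) →ₗ[ℝ] (X' → ℝ)}
  {V : (X × Option J → ℝ) →ₗ[ℝ] (X → ℝ)} {V' : (X' × Option J → ℝ) →ₗ[ℝ] (X' → ℝ)}
  {F : (X → ℝ) →ₗ[ℝ] (Y → ℝ)} {Fs : (Y → ℝ) →ₗ[ℝ] (X → ℝ)} {F' : (X' → ℝ) →ₗ[ℝ] (Y → ℝ)} {Fs' : (Y → ℝ) →ₗ[ℝ] (X' → ℝ)}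
  {W W' : (Y → ℝ) →ₗ[ℝ] (Y → ℝ)}

/-- **THE η-DEFECT OF THE DRESSED UNIT COVARIANCES FROM THE LETTERS** — S4's `hasMaj_idef_dressedSite` with the unit form in place of the site form: same data (the `U ≡ 1`
layer `G, D_μ` ∕ `G′, D′_μ`, the three perturbation letters under the guard, the species letters, uniform pairing fibres), the `U ≡ 1` UNIT COVARIANCES `W, W′ ≤ β_W·e^{−δd}` with
`(a − a²QGQ*)W = 1`, `(a − a²Q′G′Q′*)W′ = 1`, guard `β_W·(a²cAmpU)·c_r² ≤ ½`, `4σ ≤ δ` ⟹ `𝔇([K′]⁻¹, [K]⁻¹) ≤ uAmp·θ·e^{−(δ−4σ)d}`, `X = dressedOp G D V̂`.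
[cite: King1986, (2.14) p.653 + Lemma 4.5 (4.38) p.674 (shapes); Balaban1985BackgroundPropagators, (3.65)–(3.67) p.403 (mechanism), Thm 3.15 (3.187) p.432 (shape)] -/
theorem hasMaj_idef_dressedUnit (htri : Triangle254 g) (hd : ∀ a b : g.Site, 0 ≤ g.dist a b) (hrow : RowSum g σ cr) (hσ : 0 ≤ σ) (hcr : 0 ≤ cr)
    (blk : X → g.Site) (blkY : Y → g.Site) (q : X → Y) (π : X' → X) (hq : ∀ x, blk x = blkY (q x)) {N : ℕ} (hN : N ≠ 0)
    (hfib : ∀ x, (fibre π x).card = N) (a : ℝ)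
    {δ β m₀ θ K a₀ R r o₀ βW : ℝ} (hσδ : 4 * σ ≤ δ) (hβ : 0 ≤ β) (hm₀ : 0 ≤ m₀) (hθ : 0 ≤ θ) (hK : 0 ≤ K) (ha₀ : 0 ≤ a₀)
    (hq1 : β * (K * a₀) * cr ≤ 1 / 2) (hR0 : 0 ≤ R) (hRa : R ≤ K * a₀) (hr : 0 ≤ r) (ho₀ : 0 ≤ o₀) (hβW : 0 ≤ βW)
    (hq2 : βW * (a * a * cAmpU β R cr r) * cr * cr ≤ 1 / 2)
    (hG : HasMaj (BlockNorm.ofBlocks g blk) (BlockNorm.ofBlocks g blk) G (fun y y' => β * Real.exp (-(δ * g.dist y y'))))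
    (hD : ∀ μ, HasMaj (BlockNorm.ofBlocks g blk) (BlockNorm.ofBlocks g blk) (D μ) (fun y y' => β * Real.exp (-(δ * g.dist y y'))))
    (hG' : HasMaj (BlockNorm.ofBlocks g (blk ∘ π)) (BlockNorm.ofBlocks g (blk ∘ π)) G' (fun y y' => β * Real.exp (-(δ * g.dist y y'))))
    (hD' : ∀ μ, HasMaj (BlockNorm.ofBlocks g (blk ∘ π)) (BlockNorm.ofBlocks g (blk ∘ π)) (D' μ) (fun y y' => β * Real.exp (-(δ * g.dist y y'))))
    (hDG : HasMaj (BlockNorm.ofBlocks g blk) (BlockNorm.ofBlocks g (blk ∘ π)) (idef (pull π) (pull π) G' G)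
      (fun y y' => m₀ * θ * Real.exp (-(δ * g.dist y y'))))
    (hDD : ∀ μ, HasMaj (BlockNorm.ofBlocks g blk) (BlockNorm.ofBlocks g (blk ∘ π)) (idef (pull π) (pull π) (D' μ) (D μ))
      (fun y y' => m₀ * θ * Real.exp (-(δ * g.dist y y'))))
    (hV : HasMaj (BlockNorm.ofBlocks g (blkPair blk)) (BlockNorm.ofBlocks g blk) V (diagK fun _ => R))
    (hV' : HasMaj (BlockNorm.ofBlocks g (blkPair (blk ∘ π))) (BlockNorm.ofBlocks g (blk ∘ π)) V' (diagK fun _ => R))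
    (hDV : HasMaj (BlockNorm.ofBlocks g (blkPair blk)) (BlockNorm.ofBlocks g (blk ∘ π)) (idef (pull (liftPair π)) (pull π) V' V)
      (diagK fun _ => R * θ))
    (hF : HasMaj (BlockNorm.ofBlocks g blk) (BlockNorm.ofBlocks g blkY) F (diagK fun _ => r))
    (hFs : HasMaj (BlockNorm.ofBlocks g blkY) (BlockNorm.ofBlocks g blk) Fs (diagK fun _ => r))
    (hF' : HasMaj (BlockNorm.ofBlocks g (blk ∘ π)) (BlockNorm.ofBlocks g blkY) F' (diagK fun _ => r))
    (hFs' : HasMaj (BlockNorm.ofBlocks g blkY) (BlockNorm.ofBlocks g (blk ∘ π)) Fs' (diagK fun _ => r))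
    (hDF : HasMaj (BlockNorm.ofBlocks g blk) (BlockNorm.ofBlocks g blkY) (idef (pull π) LinearMap.id F' F) (diagK fun _ => o₀ * θ))
    (hDFs : HasMaj (BlockNorm.ofBlocks g blkY) (BlockNorm.ofBlocks g (blk ∘ π)) (idef LinearMap.id (pull π) Fs' Fs) (diagK fun _ => o₀ * θ))
    (hW : HasMaj (BlockNorm.ofBlocks g blkY) (BlockNorm.ofBlocks g blkY) W (fun y y' => βW * Real.exp (-(δ * g.dist y y'))))
    (hW' : HasMaj (BlockNorm.ofBlocks g blkY) (BlockNorm.ofBlocks g blkY) W' (fun y y' => βW * Real.exp (-(δ * g.dist y y'))))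
    (hKW : unitForm₀ a q G ∘ₗ W = LinearMap.id) (hKW' : unitForm₀ a (q ∘ π) G' ∘ₗ W' = LinearMap.id) :
    HasMaj (BlockNorm.ofBlocks g blkY) (BlockNorm.ofBlocks g blkY)
      (idef LinearMap.id LinearMap.id (siteInv W' (unitForm₀ a (q ∘ π) G') (unitForm a (q ∘ π) F' Fs' (dressedOp G' D' V')))
        (siteInv W (unitForm₀ a q G) (unitForm a q F Fs (dressedOp G D V))))
      (fun y y' => uAmp β R cr r m₀ K a₀ o₀ βW a * θ * Real.exp (-((δ - 4 * σ) * g.dist y y'))) := by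
  have hq' : β * R * cr ≤ 1 / 2 := (mul_le_mul_of_nonneg_right (mul_le_mul_of_nonneg_left hRa hβ) hcr).trans hq1
  have hqlt : β * R * cr < 1 := by linarith
  have hB : 0 ≤ xAmp β R cr := xAmp_nonneg hβ hqlt
  have hCU : 0 ≤ cAmpU β R cr r := cAmpU_nonneg hβ hR0 hcr hr hqlt
  have hq2lt : βW * (a * a * cAmpU β R cr r) * cr * cr < 1 := by linarith
  have hq'' : ∀ x', (blk ∘ π) x' = blkY ((q ∘ π) x') := fun x' => hq (π x')
  -- S4's three letters of the dressed propagator at the rate δ − σ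
  have hX : HasMaj (BlockNorm.ofBlocks g blk) (BlockNorm.ofBlocks g blk) (dressedOp G D V)
      (fun y y' => xAmp β R cr * Real.exp (-((δ - σ) * g.dist y y'))) :=
    hasMaj_dressedOp blk htri hd hrow hσ (ρ := δ - σ) (by linarith) (by linarith) hβ hR0 hG hD hV hqlt
  have hX' : HasMaj (BlockNorm.ofBlocks g (blk ∘ π)) (BlockNorm.ofBlocks g (blk ∘ π)) (dressedOp G' D' V')
      (fun y y' => xAmp β R cr * Real.exp (-((δ - σ) * g.dist y y'))) :=
    hasMaj_dressedOp (blk ∘ π) htri hd hrow hσ (ρ := δ - σ) (by linarith) (by linarith) hβ hR0 hG' hD' hV' hqlt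
  have hE : HasMaj (BlockNorm.ofBlocks g blk) (BlockNorm.ofBlocks g blk) (dressedOp G D V - G)
      (fun y y' => β * (R * xAmp β R cr) * cr * Real.exp (-((δ - σ) * g.dist y y'))) :=
    hasMaj_dressedOp_sub blk htri hd hrow hσ (ρ := δ - σ) (by linarith) (by linarith) hβ hR0 hG hD hV hqlt
  have hE' : HasMaj (BlockNorm.ofBlocks g (blk ∘ π)) (BlockNorm.ofBlocks g (blk ∘ π)) (dressedOp G' D' V' - G')
      (fun y y' => β * (R * xAmp β R cr) * cr * Real.exp (-((δ - σ) * g.dist y y'))) :=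
    hasMaj_dressedOp_sub (blk ∘ π) htri hd hrow hσ (ρ := δ - σ) (by linarith) (by linarith) hβ hR0 hG' hD' hV' hqlt
  have hDX := hasMaj_idef_dressedOp blk π htri hd hrow hσ hcr (by linarith : σ ≤ δ) hβ hm₀ hθ hq1 hR0 hRa hG hD hG' hD' hDG hDD hV hV' hDV
  -- U1's words at the rate δ − σ (no loss)
  have hEamp : 0 ≤ β * (R * xAmp β R cr) * cr := mul_nonneg (mul_nonneg hβ (mul_nonneg hR0 hB)) hcr
  have hC := hasMaj_unitC blk blkY q hq a hB hEamp hr hX hE hF hFs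
  have hC' := hasMaj_unitC (blk ∘ π) blkY (q ∘ π) hq'' a hB hEamp hr hX' hE' hF' hFs'
  have hDK := hasMaj_idef_unitForm blk blkY q π hq hN hfib a hB (mul_nonneg (bgConst_nonneg hβ hcr hm₀ hK ha₀) hθ) hr (mul_nonneg ho₀ hθ)
    hX' hDX hX hFs hF' hFs' hDF hDFs
  -- the `U ≡ 1` unit covariances at δ − σ
  have hW₁ : HasMaj (BlockNorm.ofBlocks g blkY) (BlockNorm.ofBlocks g blkY) W (fun y y' => βW * Real.exp (-((δ - σ) * g.dist y y'))) :=
    hasMaj_exp_mono hd hβW (by linarith) hW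
  have hW₁' : HasMaj (BlockNorm.ofBlocks g blkY) (BlockNorm.ofBlocks g blkY) W' (fun y y' => βW * Real.exp (-((δ - σ) * g.dist y y'))) :=
    hasMaj_exp_mono hd hβW (by linarith) hW'
  -- S1
  have hMK : 0 ≤ a * a * ((1 + r) * (xAmp β R cr * (o₀ * θ) + bgConst β cr m₀ K a₀ * θ * (1 + r)) + o₀ * θ * (xAmp β R cr * (1 + r))) := by
    have := bgConst_nonneg hβ hcr hm₀ hK ha₀; have := mul_self_nonneg a; positivity
  have key := hasMaj_idef_siteInv blkY htri hd hrow hσ hcr (ρ := δ - 4 * σ) hβW (mul_nonneg (mul_self_nonneg a) hCU) hMK (by linarith) (by linarith)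
    hW₁ hW₁' (hC.mono fun y y' => le_of_eq (by unfold cAmpU; ring)) (hC'.mono fun y y' => le_of_eq (by unfold cAmpU; ring)) hDK hKW hKW' hq2lt
  refine key.mono fun y y' => le_of_eq ?_
  unfold uAmp
  ring

end Dressed

end Summit.QuantumFields.YangMills.BalabanUVNodes.N15.SiteLayer

end
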